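import Mathlib
import HarnessLib

/-!
# LINE (A) `product_plus_one` (crux `MatrixDescartes`, stmt-ValiantsHypothesis-18050, V1) — W-currency TOOL (pen memo §18.1):
# the ELEMENTARY DEGREE BUDGET of the log-Wronskian `W(P) = P·θ(θP) − (θP)² = X·N`

Owner memo `pub/ideators/val-idea-25/NOTE-idea25g3-18050-LINEA-AB-reduction.md` §18.1 (val-idea-25 g4), the LINE's dense-regime closure by name:

* `logWronskian_eq_X_mul` — `W(P) = X·N`, `N = P·P′ + X·P·P″ − X·P′²`;
* `natDegree_logWronskianN_le` — `natDegree N ≤ 2·natDegree P − 2` (the `X^{2n−1}` coefficient of `N` is `a²(n + n(n−1) − n²) = 0`);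
  `natDegree_logWronskian_le` — `natDegree W(P) ≤ 2·natDegree P − 1`;
* `pow_dvd_logWronskian` — `(X − c)^{2μ−2} ∣ W(P)` for every `c`, `μ = rootMultiplicity c P` (from `(X−c)^μ ∣ P`, `(X−c)^{μ−1} ∣ P′`, `(X−c)^{μ−2} ∣ P″`);
  `le_rootMultiplicity_logWronskian` — hence `2μ − 2 ≤ rootMultiplicity c W(P)` when `W(P) ≠ 0`;
* `card_roots_logWronskian_off_le` — the budget: for `W(P) ≠ 0`, the number of DISTINCT real roots of `W(P)` that are not roots of `P`, plus
  `Σ_{c ∈ roots P} (2μ_c − 2)`, is at most `2·natDegree P − 1`.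

Honest framing: degree bookkeeping (pen §18.2: it deflates any «real-rooted rung» to the dense regime); proves nothing about `WronskianBudgetK3` /
`OneChangeFloorK3` / `stub_polyLaw` / `MatrixDescartes` / B; `VP ≠ VNP` NOT proved.  No definitions, no named facts; Mathlib only.
-/

set_option linter.dupNamespace false

namespace Summit.ValiantsHypothesis.ValiantsHypothesis.Theorems.LacunarySymmetroidMatrixDescartes

namespace ProductPlusOne

open Polynomial Finset
open scoped BigOperators

/-- `W(P) = X·N` with `N = P·P′ + X·P·P″ − X·P′²`. [pen memo §18.1] -/
theorem logWronskian_eq_X_mul (P : ℝ[X]) :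
    P * (X * derivative (X * derivative P)) - (X * derivative P) ^ 2
      = X * (P * derivative P + X * (P * derivative (derivative P)) - X * (derivative P) ^ 2) := by
  simp only [derivative_mul, derivative_X, one_mul]
  ring

/-- `natDegree N ≤ 2·natDegree P − 2` for `N = P·P′ + X·P·P″ − X·P′²`. [pen memo §18.1] -/
theorem natDegree_logWronskianN_le (P : ℝ[X]) :
    (P * derivative P + X * (P * derivative (derivative P)) - X * (derivative P) ^ 2).natDegree ≤ 2 * P.natDegree - 2 := by
  set n := P.natDegree with hn
  set N : ℝ[X] := P * derivative P + X * (P * derivative (derivative P)) - X * (derivative P) ^ 2 with hN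
  have hd1 : (derivative P).natDegree ≤ n - 1 := natDegree_derivative_le P
  have hd2 : (derivative (derivative P)).natDegree ≤ n - 2 := by
    have := natDegree_derivative_le (derivative P); omega
  by_cases hsmall : n ≤ 1
  · -- `P″ = 0`, `P′` constant: `N = P(0)·P′(0)` is a constant
    set a := P.coeff 1 with ha
    set b := P.coeff 0 with hb
    have hP1 : derivative P = C ((derivative P).coeff 0) := eq_C_of_natDegree_le_zero (by omega)
    have hP2 : derivative (derivative P) = 0 := by rw [hP1, derivative_C]
    have hcoef : (derivative P).coeff 0 = a := by rw [coeff_derivative, ha]; simp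
    have hPlin : P = C a * X + C b := by
      rcases Nat.le_one_iff_eq_zero_or_eq_one.1 hsmall with h0 | h1
      · have hc1 : a = 0 := by rw [ha]; exact coeff_eq_zero_of_natDegree_lt (by omega)
        rw [hc1, C_0, zero_mul, zero_add, hb]; exact eq_C_of_natDegree_eq_zero h0
      · have h := as_sum_range_C_mul_X_pow P
        rw [← hn, h1] at h
        rw [h]; simp [Finset.sum_range_succ, ha, hb]; ring
    have hNc : N = C (b * a) := by
      rw [hN, hP2, mul_zero, mul_zero, add_zero, hP1, hcoef, hPlin]
      simp only [map_mul]
      ring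
    rw [hNc, natDegree_C]; exact Nat.zero_le _
  · push Not at hsmall
    -- `natDegree N ≤ 2n − 1` and the `X^{2n−1}` coefficient vanishes
    have hA : (P * derivative P).natDegree ≤ 2 * n - 1 :=
      natDegree_mul_le.trans (by omega)
    have hB : (X * (P * derivative (derivative P))).natDegree ≤ 2 * n - 1 :=
      natDegree_mul_le.trans (by
        have := natDegree_mul_le (p := P) (q := derivative (derivative P))
        have hX : (X : ℝ[X]).natDegree ≤ 1 := natDegree_X_le
        omega)
    have hC : (X * (derivative P) ^ 2).natDegree ≤ 2 * n - 1 :=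
      natDegree_mul_le.trans (by
        have := natDegree_pow_le (p := derivative P) (n := 2)
        have hX : (X : ℝ[X]).natDegree ≤ 1 := natDegree_X_le
        omega)
    have hNle : N.natDegree ≤ 2 * n - 1 := by
      rw [hN]
      exact (natDegree_sub_le _ _).trans (max_le ((natDegree_add_le _ _).trans (max_le hA hB)) hC)
    -- the top coefficient
    have hc1 : (derivative P).coeff (n - 1) = P.coeff n * n := by
      rw [coeff_derivative]
      have : n - 1 + 1 = n := by omega
      rw [this]
      rw [Nat.cast_sub (by omega : 1 ≤ n)]
      push_cast
      ring
    have hc2 : (derivative (derivative P)).coeff (n - 2) = P.coeff n * n * (n - 1) := by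
      rw [coeff_derivative]
      have : n - 2 + 1 = n - 1 := by omega
      rw [this, hc1]
      rw [Nat.cast_sub (by omega : 2 ≤ n)]
      push_cast
      ring
    have htop : N.coeff (2 * n - 1) = 0 := by
      have e1 : 2 * n - 1 = n + (n - 1) := by omega
      have e2 : 2 * n - 1 = (n + (n - 2)) + 1 := by omega
      have e3 : 2 * n - 1 = ((n - 1) + (n - 1)) + 1 := by omega
      have cA : (P * derivative P).coeff (2 * n - 1) = P.coeff n * (derivative P).coeff (n - 1) := by
        rw [e1]; exact coeff_mul_add_eq_of_natDegree_le le_rfl hd1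
      have cB : (X * (P * derivative (derivative P))).coeff (2 * n - 1)
          = P.coeff n * (derivative (derivative P)).coeff (n - 2) := by
        rw [e2, coeff_X_mul]; exact coeff_mul_add_eq_of_natDegree_le le_rfl hd2
      have cC : (X * (derivative P) ^ 2).coeff (2 * n - 1) = (derivative P).coeff (n - 1) * (derivative P).coeff (n - 1) := by
        rw [e3, coeff_X_mul, sq]; exact coeff_mul_add_eq_of_natDegree_le hd1 hd1
      rw [hN, coeff_sub, coeff_add, cA, cB, cC, hc1, hc2]
      ring
    -- conclude
    have hne : N.natDegree ≠ 2 * n - 1 := by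
      intro heq
      by_cases hN0 : N = 0
      · rw [hN0, natDegree_zero] at heq; omega
      · have := leadingCoeff_ne_zero.2 hN0
        rw [leadingCoeff, heq] at this
        exact this htop
    omega

/-- `natDegree W(P) ≤ 2·natDegree P − 1`. [pen memo §18.1] -/
theorem natDegree_logWronskian_le (P : ℝ[X]) :
    (P * (X * derivative (X * derivative P)) - (X * derivative P) ^ 2).natDegree ≤ 2 * P.natDegree - 1 := by
  rw [logWronskian_eq_X_mul]
  by_cases hN : (P * derivative P + X * (P * derivative (derivative P)) - X * (derivative P) ^ 2) = 0
  · rw [hN, mul_zero, natDegree_zero]; exact Nat.zero_le _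
  by_cases hn : P.natDegree = 0
  · -- constant `P`: `N = 0`
    exfalso; apply hN
    rw [eq_C_of_natDegree_eq_zero hn]
    simp
  rw [natDegree_X_mul hN]
  have := natDegree_logWronskianN_le P
  omega

/-- **Multiplicity at the roots**: `(X − c)^{2μ − 2} ∣ W(P)` for every `c`, `μ = rootMultiplicity c P`. [pen memo §18.1] -/
theorem pow_dvd_logWronskian (P : ℝ[X]) (c : ℝ) :
    (X - C c) ^ (2 * P.rootMultiplicity c - 2) ∣ P * (X * derivative (X * derivative P)) - (X * derivative P) ^ 2 := by
  set μ := P.rootMultiplicity c with hμ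
  have hP : (X - C c) ^ μ ∣ P := pow_rootMultiplicity_dvd P c
  have h1 : μ - 1 ≤ (derivative P).rootMultiplicity c := rootMultiplicity_sub_one_le_derivative_rootMultiplicity P c
  have h2 : μ - 2 ≤ (derivative (derivative P)).rootMultiplicity c := by
    have := rootMultiplicity_sub_one_le_derivative_rootMultiplicity (derivative P) c; omega
  have hP1 : (X - C c) ^ (μ - 1) ∣ derivative P := (pow_dvd_pow _ h1).trans (pow_rootMultiplicity_dvd _ c)
  have hP2 : (X - C c) ^ (μ - 2) ∣ derivative (derivative P) := (pow_dvd_pow _ h2).trans (pow_rootMultiplicity_dvd _ c)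
  have t1 : (X - C c) ^ (2 * μ - 2) ∣ P * derivative P :=
    (pow_dvd_pow _ (by omega : 2 * μ - 2 ≤ μ + (μ - 1))).trans (by rw [pow_add]; exact mul_dvd_mul hP hP1)
  have t2 : (X - C c) ^ (2 * μ - 2) ∣ X * (P * derivative (derivative P)) :=
    Dvd.dvd.mul_left ((pow_dvd_pow _ (by omega : 2 * μ - 2 ≤ μ + (μ - 2))).trans
      (by rw [pow_add]; exact mul_dvd_mul hP hP2)) X
  have t3 : (X - C c) ^ (2 * μ - 2) ∣ X * (derivative P) ^ 2 :=
    Dvd.dvd.mul_left ((pow_dvd_pow _ (by omega : 2 * μ - 2 ≤ (μ - 1) + (μ - 1))).trans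
      (by rw [pow_add, sq]; exact mul_dvd_mul hP1 hP1)) X
  rw [logWronskian_eq_X_mul]
  exact Dvd.dvd.mul_left ((t1.add t2).sub t3) X

/-- Hence `2μ − 2 ≤ rootMultiplicity c W(P)` whenever `W(P) ≠ 0`. [pen memo §18.1] -/
theorem le_rootMultiplicity_logWronskian (P : ℝ[X]) (c : ℝ)
    (hW : P * (X * derivative (X * derivative P)) - (X * derivative P) ^ 2 ≠ 0) :
    2 * P.rootMultiplicity c - 2 ≤ (P * (X * derivative (X * derivative P)) - (X * derivative P) ^ 2).rootMultiplicity c :=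
  (le_rootMultiplicity_iff hW).2 (pow_dvd_logWronskian P c)

/-- ★ **THE DEGREE BUDGET**: for `W(P) ≠ 0`, (number of distinct real roots of `W(P)` off the roots of `P`) + `Σ_{c ∈ roots P} (2μ_c − 2)`
`≤ 2·natDegree P − 1`. [pen memo §18.1] -/
theorem card_roots_logWronskian_off_le (P : ℝ[X])
    (hW : P * (X * derivative (X * derivative P)) - (X * derivative P) ^ 2 ≠ 0) :
    ((P * (X * derivative (X * derivative P)) - (X * derivative P) ^ 2).roots.toFinset.filter (fun t => ¬ P.IsRoot t)).card
        + ∑ c ∈ P.roots.toFinset, (2 * P.rootMultiplicity c - 2) ≤ 2 * P.natDegree - 1 := by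
  classical
  set W : ℝ[X] := P * (X * derivative (X * derivative P)) - (X * derivative P) ^ 2 with hWdef
  have hP : P ≠ 0 := by
    rintro rfl; exact hW (by rw [hWdef]; simp)
  set S := W.roots.toFinset.filter (fun t => ¬ P.IsRoot t) with hS
  -- both pieces are bounded by multiplicities of roots of `W`, over disjoint sets
  have hdisj : Disjoint S P.roots.toFinset := by
    rw [Finset.disjoint_left]
    intro t ht htP
    rw [hS, Finset.mem_filter] at ht
    exact ht.2 ((mem_roots hP).1 (Multiset.mem_toFinset.1 htP))
  have h1 : S.card ≤ ∑ c ∈ S, W.roots.count c := by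
    rw [Finset.card_eq_sum_ones]
    refine Finset.sum_le_sum fun c hc => ?_
    rw [hS, Finset.mem_filter, Multiset.mem_toFinset] at hc
    exact Multiset.one_le_count_iff_mem.2 hc.1
  have h2 : ∑ c ∈ P.roots.toFinset, (2 * P.rootMultiplicity c - 2) ≤ ∑ c ∈ P.roots.toFinset, W.roots.count c :=
    Finset.sum_le_sum fun c _ => by rw [count_roots]; exact le_rootMultiplicity_logWronskian P c hW
  have h3 : ∑ c ∈ S ∪ P.roots.toFinset, W.roots.count c ≤ Multiset.card W.roots := by
    calc ∑ c ∈ S ∪ P.roots.toFinset, W.roots.count c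
        ≤ ∑ c ∈ W.roots.toFinset, W.roots.count c := by
          refine Finset.sum_le_sum_of_ne_zero fun c hc hne => ?_
          rw [Multiset.mem_toFinset, ← Multiset.count_pos]
          exact Nat.pos_of_ne_zero hne
      _ = Multiset.card W.roots := Multiset.toFinset_sum_count_eq _
  have h4 : Multiset.card W.roots ≤ 2 * P.natDegree - 1 := (card_roots' W).trans (natDegree_logWronskian_le P)
  rw [Finset.sum_union hdisj] at h3
  omega

end ProductPlusOne

end Summit.ValiantsHypothesis.ValiantsHypothesis.Theorems.LacunarySymmetroidMatrixDescartes
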